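import Summits.ResolutionOfSingularities.ResolutionOfSingularities.Theorems.PurelyInseparableDim4ResConeConstantSupportTail
import HarnessLib
import HarnessLib.Audit.Tags

/-!
# Purely inseparable four-folds — TWO STEPS AFTER EVERY LATE SATELLITE STEP THE LETTER COUNT OF A BINARY-CONE TAIL IS MAXIMAL,
# for EVERY prime `p` and EVERY shade (K2(p) lane, slice C, rung-1 generic structure over the support-confined re-presentation;
# seat res-dim4-p-1 g6)

[OURS · counted 0 · cell `res-dim4-pi` · K2(p) lane (holder lineage res-dim4-p-12; rung-1 generic bricks «no `7` in a signature»,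
desk WORD #193 (δ)) · seat res-dim4-p-1 g6.]  Nothing here proves K2(p) for any `p ≥ 7`, any TAIL(7, d, e), `NoIsolatedTrap p p`, the
Cossart–Jannsen–Saito theorem or resolution of singularities in dimension ≥ 4 / characteristic `p` — NOT proved; structure statements about
OUR frame's hypothetical `Step0 p` chains.  AI kernel work, weaker than expert review.

THE STATEMENT.  Along a witnessed isolated above-floor `Step0 p` chain with `x^{r₀} ∣ F₀`, constant shade `d` and `e_G ≡ 2` from `k₀`, let
`n_k := #supp r_k` be the number of boundary letters.  `…ResConeSupportConfinedRepresentation` (p711054) built the `S`-confined honest partner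
from SOME late satellite time; here the same construction is run from EVERY satellite time `k ≥ k₀` (§1, `support_representation_at_satellite`:
entry `kₑ = k + 2`, `S = supp r_{k+2}`), and read off:
* §2 **`support_card_le_after_satellite (p)`** — for every satellite step `k ≥ k₀` and every `k′ ≥ k + 2`: `n_{k′} ≤ n_{k+2}` (no `d < p`):
  the partner is confined to `supp r_{k+2}` and carries the real letter count (`card_support_le_of_confined`);
* §2 **`support_card_eventually_le_max (p)` / `support_card_eq_max_after_satellite (p)`** — there are `M` and `k₁ ≥ k₀` with `n_k ≤ M` for all
  `k ≥ k₁`, `n_{k+2} = M` two steps after EVERY satellite step `k ≥ k₁`, and (FT) such steps beyond every time; with `d < p` moreover `n_k < M`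
  beyond every time (`support_card_not_eventually_constant`, `…ResConeConstantSupportTail`): **a binary-cone trap oscillates below a ceiling
  `M` which it touches two steps after each of its (infinitely many) satellite steps.**
LEDGER READING (for the size-oscillating zoo rows of the holder's exit table, no `7` here): inside a surviving SCC-orbit, every SATELLITE edge
`k → k+1` (chart `j (k+1) ≠ j k`, `x_{j k}` untranslated) that a tail uses infinitely often must be followed by a state of the tail's MAXIMAL
letter count; edges violating this are used finitely often and may be deleted before the SCC analysis.
[cite: CossartJannsenSaito2020, Thm. 3.10(4), Thm. 3.14, Thm. 9.3, Lemma 13.2, Thm. 13.7] [cite: Hauser2010, §§F–G (chart expressions of a point blowup; cleaning)]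
bears_on: LADDER-RESOLUTION:D157-DOOR2 (res-dim4-pi · K2(p) = `RidgeBudget.NoAboveFloorTrap p p` · slice C · rung-1 generic: letter count
maximal after every satellite step).  Supports stmt-ResolutionOfSingularities-16155 (helper).
-/

set_option linter.dupNamespace false -- mandated namespace of this single-conjunct summit

noncomputable section

namespace Summit.ResolutionOfSingularities.ResolutionOfSingularities.Theorems.PIDim4

namespace ResCone

open MvPolynomial Finset
open Literature.AlgebraicGeometry.Resolution
open Literature.AlgebraicGeometry.Resolution.CentreBlowup
open Literature.AlgebraicGeometry.Resolution.Hauser2010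
open Literature.AlgebraicGeometry.Resolution.HauserPerlega2019

variable {K : Type} [Field K] [DecidableEq K] (p : ℕ) [Fact p.Prime] [CharP K p]

/-! ## §1 The support-confined partner from a GIVEN satellite time -/

/-- **SUPPORT-CONFINED RE-PRESENTATION FROM A GIVEN SATELLITE TIME** (every prime `p`, every shade): `support_representation_of_satellite`
(p711054) with the satellite step `k ≥ k₀` prescribed — entry `kₑ = k + 2`, `S = supp r_{k+2}`; same conclusion (honest witnessed isolated
above-floor `Step0 p` partner `c′`, `c′ 0 = c (k+2)`, weights renamed, confined to `S`, charts in `S`, TT for `S`, shade `d`, `e_G ≡ 2`).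
[OURS] [cite: CossartJannsenSaito2020, Thm. 3.10(4), Thm. 3.14, Thm. 9.3] [cite: Hauser2010, §§F–G (chart expressions of a point blowup; cleaning)] -/
theorem support_representation_at_satellite {c : ℕ → State K} {j : ℕ → Fin 4} {b : ℕ → Fin 4 → K}
    (hc : ∀ k, IsIsolated p (c k).F ∧ Step0 p (c k) (c (k + 1))) (hw : FreeTail.IsWitnessedChain p c j b)
    (hr0 : ∀ e ∈ (c 0).F.support, (c 0).r ≤ e) (hfloor : ∀ k, ordZero (c k).F ≠ p) {k₀ d : ℕ}
    (hshade : ∀ k, k₀ ≤ k → (c k).shade = (d : ℕ∞)) (he : ∀ k, k₀ ≤ k → Module.finrank K (resVertex (c k)) = 2)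
    {k : ℕ} (hk : k₀ ≤ k) (hsat : FreeTail.IsSatellite j b k) :
    ∃ (c' : ℕ → State K) (j' : ℕ → Fin 4) (b' : ℕ → Fin 4 → K), c' 0 = c (k + 2) ∧
      (∀ t, ∃ π : Equiv.Perm (Fin 4), (c' t).r = Finsupp.mapDomain (Equiv.symm π) (c (k + 2 + t)).r) ∧
      (∀ t, ∀ i, i ∉ (c (k + 2)).r.support → (c' t).r i = 0) ∧ (∀ t, j' t ∈ (c (k + 2)).r.support) ∧
      (∀ t, ∀ v ∈ resVertex (c' t), (∀ i ∈ (c (k + 2)).r.support, v i = 0) → v = 0) ∧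
      (∀ t, IsIsolated p (c' t).F ∧ Step0 p (c' t) (c' (t + 1))) ∧ FreeTail.IsWitnessedChain p c' j' b' ∧
      (∀ e ∈ (c' 0).F.support, (c' 0).r ≤ e) ∧ (∀ t, ordZero (c' t).F ≠ p) ∧
      (∀ t, 0 ≤ t → (c' t).shade = (d : ℕ∞)) ∧ (∀ t, 0 ≤ t → Module.finrank K (resVertex (c' t)) = 2) := by
  have hstep : ∀ k, c (k + 1) = CentreBlowup.step p Finset.univ (j k) (b k) (c k) := fun k => (hw k).2.2.2.2
  have hdivk : ∀ k, ∀ e ∈ (c k).F.support, (c k).r ≤ e := IsolatedBand.isolated_chain_forall_le hc hr0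
  have hord : ∀ m, k₀ ≤ m → ordZero (c m).F = (((c m).r.degree + d : ℕ) : ℕ∞) ∧ p < (c m).r.degree + d := by
    intro m hm
    obtain ⟨o, ho, hpo, -, hod⟩ := chain_shade_nat p hc hfloor hshade hm
    have hro := degree_r_le ho (hdivk m)
    refine ⟨?_, by omega⟩
    rw [ho]; congr 1; omega
  -- (1) entry at `k + 2`
  obtain ⟨-, -, -, hTT, hclean⟩ := support_entry_of_satellite p hc hw hr0 hfloor hshade he hk hsat
  set S : Finset (Fin 4) := (c (k + 2)).r.support with hS
  have hsupp : ∀ i, i ∉ S → (c (k + 2)).r i = 0 := fun i hi => Finsupp.notMem_support_iff.mp hi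
  have hentry := SwapTransport.supportInv_refl p S hclean (hdivk (k + 2)) hsupp (hc (k + 2)).1 (he (k + 2) (by omega)) hTT
  -- (2) the virtual chain
  obtain ⟨c', j', b', h0, hInv, hc', hw', hr0', hfloor', hshade', he', hletters, hpass⟩ :=
    support_virtual_chain (K := K) p S (d := d) (B₀ := c (k + 2))
      (Inv := fun t B => ∃ π : Equiv.Perm (Fin 4), (B.r = Finsupp.mapDomain (Equiv.symm π) (c (k + 2 + t)).r ∧
        (∀ i, i ∉ S → B.r i = 0) ∧ ordZero B.F = ordZero (c (k + 2 + t)).F ∧ B.shade = (c (k + 2 + t)).shade ∧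
        (∀ d ∈ B.F.support, B.r ≤ d) ∧ IsIsolated p B.F ∧ Module.finrank K (ResCone.resVertex B) = 2 ∧
        (∀ v ∈ ResCone.resVertex B, (∀ i ∈ S, v i = 0) → v = 0) ∧
        ∃ (Θ e : ℕ → Fin 4 → MvPolynomial (Fin 4) K), (∀ M k, Θ (M + 1) k - Θ M k ∈ originIdeal K ^ (M + 2)) ∧
          ∀ M, (∀ k, constantCoeff (Θ M k) = 0) ∧
            (∀ i, B.r i ≠ 0 → Θ M (π i) = X i * e M i ∧ constantCoeff (e M i) ≠ 0) ∧
            IsUnit (Matrix.det (Matrix.of fun k m => coeff (Finsupp.single m 1) (Θ M k))) ∧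
            ∃ U E : MvPolynomial (Fin 4) K, constantCoeff U ≠ 0 ∧ E ∈ originIdeal K ^ M ∧
              B.F = deletePthPowers p (U ^ p * aeval (Θ M) (c (k + 2 + t)).F) + E))
      ⟨1, hentry⟩
      (fun t B hB => by
        obtain ⟨π, hr, hconfB, hoB, -, hdivB, hisoB, heB, -, -⟩ := hB
        have hkt : k₀ ≤ k + 2 + t := by omega
        obtain ⟨ho, hpo⟩ := hord (k + 2 + t) hkt
        refine ⟨hisoB, ?_, ?_, heB, hconfB, hdivB⟩
        · rw [hoB, ho, hr, Finsupp.degree_mapDomain]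
        · rw [hr, Finsupp.degree_mapDomain]; exact hpo)
      (fun t B hB => by
        obtain ⟨π, hinv⟩ := hB
        have hkt : k₀ ≤ k + 2 + t := by omega
        have hkt1 : k₀ ≤ k + 2 + t + 1 := by omega
        obtain ⟨o, ho, hpo, ho2⟩ := chain_band p hc hfloor (k + 2 + t)
        obtain ⟨o', ho', hpo', ho2'⟩ := chain_band p hc hfloor (k + 2 + t + 1)
        have hsh : (c (k + 2 + t + 1)).shade = (c (k + 2 + t)).shade := by rw [hshade _ hkt1, hshade _ hkt]
        obtain ⟨ℓ, β, π', hℓ, hβ, hinv'⟩ := SwapTransport.support_virtual_step p S (c (k + 2 + t)) (c (k + 2 + t + 1)) B π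
          (j (k + 2 + t)) (b (k + 2 + t)) (hw (k + 2 + t)).2.1 (hstep (k + 2 + t)) (hdivk _) (hdivk _) ⟨o, ho, hpo, ho2⟩
          ⟨o', ho', hpo', ho2'⟩ hsh (hc (k + 2 + t + 1)).1 (he _ hkt1) hinv
        exact ⟨ℓ, β, hℓ, hβ, π', hinv'⟩)
  refine ⟨c', j', b', h0, fun t => ?_, hpass, hletters, fun t => ?_, hc', hw', hr0', hfloor', hshade', he'⟩
  · obtain ⟨π, hr, -⟩ := hInv t
    exact ⟨π, hr⟩
  · obtain ⟨π, -, -, -, -, -, -, -, hTTt, -⟩ := hInv t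
    exact hTTt

/-! ## §2 The letter count after a satellite step -/

/-- **AFTER EVERY LATE SATELLITE STEP THE LETTER COUNT NEVER AGAIN EXCEEDS ITS VALUE TWO STEPS LATER** (every prime `p`, every shade; no
`d < p`): for a satellite step `k ≥ k₀` and every `k′ ≥ k + 2`, `#supp r_{k′} ≤ #supp r_{k+2}`. [OURS]
[cite: CossartJannsenSaito2020, Thm. 3.10(4), Thm. 3.14, Thm. 9.3] -/
theorem support_card_le_after_satellite {c : ℕ → State K} {j : ℕ → Fin 4} {b : ℕ → Fin 4 → K}
    (hc : ∀ k, IsIsolated p (c k).F ∧ Step0 p (c k) (c (k + 1))) (hw : FreeTail.IsWitnessedChain p c j b)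
    (hr0 : ∀ e ∈ (c 0).F.support, (c 0).r ≤ e) (hfloor : ∀ k, ordZero (c k).F ≠ p) {k₀ d : ℕ}
    (hshade : ∀ k, k₀ ≤ k → (c k).shade = (d : ℕ∞)) (he : ∀ k, k₀ ≤ k → Module.finrank K (resVertex (c k)) = 2)
    {k : ℕ} (hk : k₀ ≤ k) (hsat : FreeTail.IsSatellite j b k) {k' : ℕ} (hk' : k + 2 ≤ k') :
    (c k').r.support.card ≤ (c (k + 2)).r.support.card := by
  obtain ⟨c', j', b', -, hperm, hconf, -⟩ := support_representation_at_satellite p hc hw hr0 hfloor hshade he hk hsat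
  obtain ⟨π, hr⟩ := hperm (k' - (k + 2))
  have h := card_support_le_of_confined hr (hconf (k' - (k + 2)))
  rwa [show k + 2 + (k' - (k + 2)) = k' by omega] at h

/-- **THE CEILING**: there are `M` and `k₁ ≥ k₀` such that `#supp r_k ≤ M` for every `k ≥ k₁` and `#supp r_{k+2} = M` two steps after EVERY
satellite step `k ≥ k₁` — and satellite steps occur beyond every time (FT).  Every prime `p`, every shade; no `d < p`. [OURS]
[cite: CossartJannsenSaito2020, Thm. 3.10(4), Thm. 3.14, Thm. 9.3] -/
theorem support_card_eq_max_after_satellite {c : ℕ → State K} {j : ℕ → Fin 4} {b : ℕ → Fin 4 → K}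
    (hc : ∀ k, IsIsolated p (c k).F ∧ Step0 p (c k) (c (k + 1))) (hw : FreeTail.IsWitnessedChain p c j b)
    (hr0 : ∀ e ∈ (c 0).F.support, (c 0).r ≤ e) (hfloor : ∀ k, ordZero (c k).F ≠ p) {k₀ d : ℕ}
    (hshade : ∀ k, k₀ ≤ k → (c k).shade = (d : ℕ∞)) (he : ∀ k, k₀ ≤ k → Module.finrank K (resVertex (c k)) = 2) :
    ∃ M k₁, k₀ ≤ k₁ ∧ (∀ k, k₁ ≤ k → (c k).r.support.card ≤ M) ∧
      (∀ k, k₁ ≤ k → FreeTail.IsSatellite j b k → (c (k + 2)).r.support.card = M) ∧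
      (∀ N, ∃ k, N ≤ k ∧ FreeTail.IsSatellite j b k) := by
  classical
  -- the post-satellite counts `n_{k+2}`, `k ≥ k₀` satellite, form a non-empty set of naturals; take its minimum `M`
  have hsat_ex : ∀ N, ∃ k, N ≤ k ∧ FreeTail.IsSatellite j b k := fun N => exists_satellite_ge p hc hw N
  let P : ℕ → Prop := fun m => ∃ k, k₀ ≤ k ∧ FreeTail.IsSatellite j b k ∧ (c (k + 2)).r.support.card = m
  have hP : ∃ m, P m := by
    obtain ⟨k, hk, hsat⟩ := hsat_ex k₀
    exact ⟨_, k, hk, hsat, rfl⟩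
  obtain ⟨ks, hks, hsats, hM⟩ := Nat.find_spec hP
  refine ⟨Nat.find hP, ks + 2, by omega, fun k hk => ?_, fun k hk hsat => le_antisymm ?_ ?_, hsat_ex⟩
  · rw [← hM]
    exact support_card_le_after_satellite p hc hw hr0 hfloor hshade he hks hsats hk
  · rw [← hM]
    exact support_card_le_after_satellite p hc hw hr0 hfloor hshade he hks hsats (by omega)
  · exact Nat.find_min' hP ⟨k, by omega, hsat, rfl⟩

/-- **THE OSCILLATION BELOW THE CEILING** (every prime `p`, every shade `d < p`): with `M`, `k₁` as in
`support_card_eq_max_after_satellite`, the count is `< M` beyond every time as well — a binary-cone trap touches its ceiling two steps after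
each of its infinitely many satellite steps and leaves it again infinitely often. [OURS]
[cite: CossartJannsenSaito2020, Thm. 3.10(4), Thm. 3.14, Thm. 9.3, Lemma 13.2, Thm. 13.7] -/
theorem support_card_oscillates {c : ℕ → State K} {j : ℕ → Fin 4} {b : ℕ → Fin 4 → K}
    (hc : ∀ k, IsIsolated p (c k).F ∧ Step0 p (c k) (c (k + 1))) (hw : FreeTail.IsWitnessedChain p c j b)
    (hr0 : ∀ e ∈ (c 0).F.support, (c 0).r ≤ e) (hfloor : ∀ k, ordZero (c k).F ≠ p) {k₀ d : ℕ} (hdp : d < p)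
    (hshade : ∀ k, k₀ ≤ k → (c k).shade = (d : ℕ∞)) (he : ∀ k, k₀ ≤ k → Module.finrank K (resVertex (c k)) = 2) :
    ∃ M k₁, k₀ ≤ k₁ ∧ (∀ k, k₁ ≤ k → (c k).r.support.card ≤ M) ∧
      (∀ k, k₁ ≤ k → FreeTail.IsSatellite j b k → (c (k + 2)).r.support.card = M) ∧
      (∀ N, ∃ k, N ≤ k ∧ (c k).r.support.card = M) ∧ (∀ N, ∃ k, N ≤ k ∧ (c k).r.support.card < M) := by
  obtain ⟨M, k₁, hk₁, hle, hmax, hsat⟩ := support_card_eq_max_after_satellite p hc hw hr0 hfloor hshade he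
  refine ⟨M, k₁, hk₁, hle, hmax, fun N => ?_, fun N => ?_⟩
  · obtain ⟨k, hk, hs⟩ := hsat (max N k₁)
    exact ⟨k + 2, by omega, hmax k (by omega) hs⟩
  · by_contra hno
    push Not at hno
    -- then the count is `= M` from `max N k₁` on: constant — impossible
    have hconst : ∀ k, max N k₁ ≤ k → (c k).r.support.card = M := fun k hk =>
      le_antisymm (hle k (by omega)) (hno k (by omega))
    exact no_constant_support_tail p hc hw hr0 hfloor hdp (k₀ := max N k₁) (fun k hk => hshade k (by omega))
      (fun k hk => he k (by omega)) hconst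

end ResCone

end Summit.ResolutionOfSingularities.ResolutionOfSingularities.Theorems.PIDim4

end
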